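import Literature.NumberTheory.Automorphic.ChevalleyGroupData
import Literature.NumberTheory.Automorphic.LieAlgebraGLDimension
import Literature.NumberTheory.Automorphic.LieAlgebraGLStabilizer
import HarnessLib

/-!
# The Lie algebra and the dimension of the weight torus (Springer 3.2, 4.4)

Trunk T-AUTOMORPHIC (G25 AutomorphicL); companion of `WeightTorus.lean` (the weight torus
`T_X = weightTorus k wt ≤ GL m k` of weights `wt : m → X` generating the lattice `X`),
`LieAlgebraGL.lean` / `LieAlgebraGLDimension.lean` (`lieAlgebraGL`, `tangentDeriv`,
`IsZConnected.zdim`, `dim Lie(H) = dim H`) and `ChevalleyGroupData.lean` (the torus Lie algebra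
`torusLie wt = {diag (ℓ (wt a)) | ℓ ∈ Hom(X, k)}`), towards Chevalley's existence theorem
(`Literature.NumberTheory.Automorphic.chevalley_existence`, Springer 10.1.1): the maximal-torus
and reductivity arguments for the group `⟨T_X, exp (x E_α)⟩` need **`Lie (T_X) = 𝔱_V`** and
**`dim T_X = rank X`**. Everything is proved:

* `lieAlgebraGL_weightTorus_le`: `Lie (T_X) ≤ 𝔱_V` over any field — the off-diagonal
  coordinates and the monomial relations `∏ x_aa ^ {v_a⁺} = ∏ x_aa ^ {v_a⁻}` (`v ∈ ker (wtHom wt)`,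
  Springer 3.2.10 (4)) vanish on `T_X`, and their differentials at `1` are `A a c` and
  `∑ v_a A a a` (`tangentDeriv_diagMonomial`), so a tangent vector is a diagonal matrix whose
  entries kill the relations among the weights, i.e. factor through `X` (`exists_addMonoidHom_of_forall_ker`);
* `finrank_torusLie`: `dim 𝔱_V = rank X` (`𝔱_V ≅ Hom(X, k) ≅ k^{rank X}`);
* `rank_le_zdim_weightTorus`: `rank X ≤ dim T_X` over an algebraically closed field, by the chain
  of weight tori `T_0 < T_1 < ⋯ < T_r ≤ T_X` of the truncated coordinate weights
  `wt_s = (first s coordinates of wt in a ℤ-basis of X)` (each `T_s` is Zariski-connected by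
  `isZConnected_weightTorus`, and `T_s ≠ T_{s+1}` is witnessed by the character `c ^ {v_{s}}`,
  `c ≠ 1`, using the injectivity of `Hom(ℤ^{s+1}, kˣ) → T_{s+1}`), with Springer 1.8.2
  (`IsZConnected.zdim_lt_of_lt`);
* `lieAlgebraGL_weightTorus_eq`: **`Lie (T_X) = 𝔱_V`** and `zdim_weightTorus_eq`:
  **`dim T_X = rank X`** over an algebraically closed field (Springer 3.2.7 with 4.4.6:
  `dim Lie = dim`, `IsZConnected.finrank_lieAlgebraGL_eq`).

## Mathlib

`Module.finBasis`, `Module.Basis.equivFun`, `Module.Basis.constr`, `addMonoidHomLequivInt`,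
`AddMonoidHom.liftOfSurjective`, `LinearMap.finrank_range_of_inj`, `Submodule.eq_of_le_of_finrank_le`,
`MvPolynomial.vanishingIdeal`. Mathlib has no algebraic tori; nothing here duplicates a Mathlib
declaration.

## References

* [SpringerLAG1998] T. A. Springer, *Linear Algebraic Groups*, 2nd ed., Progress in Mathematics 9,
  Birkhäuser (1998): 1.8.2, 3.2.7, 3.2.10 (4), 4.4.6, 10.1.1.
-/

noncomputable section

open scoped MatrixGroups
open MvPolynomial

namespace Literature.NumberTheory.Automorphic

variable {k : Type*} [Field k]
variable {X : Type*} [AddCommGroup X]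
variable {n : Type*} [Fintype n] [DecidableEq n]

/-! ### Polynomials vanishing on the weight torus and their differentials -/

section Vanishing

variable {wt : n → X}

/-- Elements of the weight torus are the diagonal matrices `diag (χ (wt a))`. [folklore] -/
lemma exists_eq_diagonal_of_mem_weightTorus {g : GL n k} (hg : g ∈ weightTorus k wt) :
    ∃ χ : Multiplicative X →* kˣ,
      (g : Matrix n n k) = Matrix.diagonal fun a => (χ (Multiplicative.ofAdd (wt a)) : k) := by
  obtain ⟨χ, rfl⟩ := hg
  exact ⟨χ, by rw [weightTorusHom_apply, coe_diagonalGL]⟩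

/-- The off-diagonal coordinates vanish on the weight torus. [folklore] -/
lemma X_inl_mem_vanishingIdeal_weightTorus {a c : n} (hac : a ≠ c) :
    (MvPolynomial.X (Sum.inl (a, c)) : MvPolynomial (GLCoord n) k) ∈
      MvPolynomial.vanishingIdeal k (glCoordFun '' ((weightTorus k wt : Subgroup (GL n k)) :
        Set (GL n k))) := by
  rw [MvPolynomial.mem_vanishingIdeal_iff]
  rintro _ ⟨g, hg, rfl⟩
  obtain ⟨χ, hχ⟩ := exists_eq_diagonal_of_mem_weightTorus hg
  rw [MvPolynomial.aeval_X, glCoordFun_inl, hχ, Matrix.diagonal_apply_ne _ hac]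

variable (k n) in
/-- The diagonal monomial `∏_a x_aa ^ {e a}` in the coordinates of `GL n`. [folklore] -/
def diagMonomial (e : n → ℕ) : MvPolynomial (GLCoord n) k :=
  ∏ a, MvPolynomial.X (Sum.inl (a, a)) ^ e a

/-- Evaluation of the diagonal monomial. [folklore] -/
lemma eval_diagMonomial (e : n → ℕ) (g : GL n k) :
    MvPolynomial.eval (glCoordFun g) (diagMonomial k n e) = ∏ a, (g : Matrix n n k) a a ^ e a := by
  simp [diagMonomial]

/-- The differential at `1` of a power of a polynomial with `p (1) = 1`:
`d (p ^ e)_1 = e · dp_1`. [folklore] -/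
lemma tangentDeriv_pow_of_eval_one {p : MvPolynomial (GLCoord n) k}
    (hp : MvPolynomial.eval (glCoordFun (1 : GL n k)) p = 1) (e : ℕ) (A : Matrix n n k) :
    tangentDeriv (p ^ e) A = (e : k) * tangentDeriv p A := by
  induction e with
  | zero => rw [pow_zero, ← MvPolynomial.C_1, tangentDeriv_C, Nat.cast_zero, zero_mul]
  | succ e ih =>
    rw [pow_succ, tangentDeriv_mul, ih, map_pow, hp, one_pow, one_mul, mul_one, Nat.cast_succ]
    ring

/-- **The differential at `1` of a product of powers of polynomials with value `1` at `1`**: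
`d (∏ p_i ^ {e_i})_1 = ∑ e_i d(p_i)_1` (and the product has value `1` at `1`). [folklore] -/
lemma tangentDeriv_prod_pow_of_eval_one {ι' : Type*} (s : Finset ι')
    (p : ι' → MvPolynomial (GLCoord n) k)
    (hp : ∀ i, MvPolynomial.eval (glCoordFun (1 : GL n k)) (p i) = 1) (e : ι' → ℕ)
    (A : Matrix n n k) :
    MvPolynomial.eval (glCoordFun (1 : GL n k)) (∏ i ∈ s, p i ^ e i) = 1 ∧
      tangentDeriv (∏ i ∈ s, p i ^ e i) A = ∑ i ∈ s, (e i : k) * tangentDeriv (p i) A := by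
  classical
  induction s using Finset.induction_on with
  | empty =>
    refine ⟨by simp, ?_⟩
    rw [Finset.prod_empty, Finset.sum_empty, ← MvPolynomial.C_1, tangentDeriv_C]
  | insert a s ha ih =>
    refine ⟨?_, ?_⟩
    · rw [Finset.prod_insert ha, map_mul, ih.1, map_pow, hp, one_pow, one_mul]
    · rw [Finset.prod_insert ha, Finset.sum_insert ha, tangentDeriv_mul, ih.1, ih.2, map_pow,
        hp, one_pow, mul_one, one_mul, tangentDeriv_pow_of_eval_one (hp a), add_comm]

/-- **The differential of the diagonal monomial**: `d (∏ x_aa ^ {e a})_1 (A) = ∑_a e_a A a a`.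
[folklore] -/
lemma tangentDeriv_diagMonomial (e : n → ℕ) (A : Matrix n n k) :
    tangentDeriv (diagMonomial k n e) A = ∑ a, (e a : k) * A a a := by
  have hX1 : ∀ a : n, MvPolynomial.eval (glCoordFun (1 : GL n k))
      (MvPolynomial.X (Sum.inl (a, a)) : MvPolynomial (GLCoord n) k) = 1 := fun a => by
    simp
  rw [diagMonomial, (tangentDeriv_prod_pow_of_eval_one Finset.univ _ hX1 e A).2]
  refine Finset.sum_congr rfl fun a _ => ?_
  rw [tangentDeriv_X]
  rfl

omit [Fintype n] [DecidableEq n] in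
/-- The positive and negative parts of an integer vector recover it: `v⁺ - v⁻ = v`. [folklore] -/
lemma toNat_sub_toNat_neg_eq (v : n → ℤ) (a : n) :
    (((v a).toNat : ℕ) : ℤ) - (((-v a).toNat : ℕ) : ℤ) = v a :=
  Int.toNat_sub_toNat_neg (v a)

/-- **The monomial relations vanish on the weight torus**: for a relation `v` among the weights
(`∑ v_a wt a = 0`), `∏ x_aa ^ {v_a⁺} - ∏ x_aa ^ {v_a⁻}` vanishes on `T_X` (Springer 3.2.10 (4)).
[folklore] -/
lemma diagMonomial_sub_mem_vanishingIdeal_weightTorus {v : n → ℤ} (hv : v ∈ (wtHom wt).ker) :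
    diagMonomial k n (fun a => (v a).toNat) - diagMonomial k n (fun a => (-v a).toNat) ∈
      MvPolynomial.vanishingIdeal k (glCoordFun '' ((weightTorus k wt : Subgroup (GL n k)) :
        Set (GL n k))) := by
  rw [MvPolynomial.mem_vanishingIdeal_iff]
  rintro _ ⟨g, hg, rfl⟩
  obtain ⟨χ, hχ⟩ := exists_eq_diagonal_of_mem_weightTorus hg
  change MvPolynomial.eval (glCoordFun g)
    (diagMonomial k n (fun a => (v a).toNat) - diagMonomial k n (fun a => (-v a).toNat)) = 0
  rw [map_sub, eval_diagMonomial, eval_diagMonomial, hχ, sub_eq_zero]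
  simp only [Matrix.diagonal_apply_eq]
  -- `∏ d_a ^ v_a = 1` with `d_a = χ (wt a)`
  have h1 : ∏ a, χ (Multiplicative.ofAdd (wt a)) ^ v a = 1 := prod_zpow_eq_one_of_mem_ker χ hv
  have h2 : ∀ a, χ (Multiplicative.ofAdd (wt a)) ^ v a =
      χ (Multiplicative.ofAdd (wt a)) ^ (v a).toNat * (χ (Multiplicative.ofAdd (wt a)) ^
        (-v a).toNat)⁻¹ := by
    intro a
    rw [← zpow_natCast, ← zpow_natCast, ← zpow_neg, ← zpow_add, ← sub_eq_add_neg,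
      toNat_sub_toNat_neg_eq]
  simp_rw [h2] at h1
  rw [Finset.prod_mul_distrib, Finset.prod_inv_distrib, mul_inv_eq_one] at h1
  have h3 := congrArg (fun u : kˣ => (u : k)) h1
  simpa only [Units.coe_prod, Units.val_pow_eq_pow_val] using h3

/-- **An additive map out of the exponent vectors killing the relations among the weights factors
through `X`** (when the weights generate `X`): if `∑_a v_a δ_a = 0` for all `v ∈ ker (wtHom wt)`
then `δ_a = ℓ (wt a)` for some `ℓ ∈ Hom(X, k)`. [folklore] -/
lemma exists_addMonoidHom_of_forall_ker (hwt : Function.Surjective (wtHom wt)) {δ : n → k}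
    (hδ : ∀ v ∈ (wtHom wt).ker, ∑ a, (v a : k) * δ a = 0) :
    ∃ ℓ : X →+ k, ∀ a, ℓ (wt a) = δ a := by
  classical
  let ψ : (n → ℤ) →+ k :=
    { toFun := fun v => ∑ a, (v a : k) * δ a
      map_zero' := by simp
      map_add' := fun v w => by
        simp only [Pi.add_apply, Int.cast_add, add_mul, Finset.sum_add_distrib] }
  have hψ : (wtHom wt).ker ≤ ψ.ker := fun v hv => (AddMonoidHom.mem_ker).2 (hδ v hv)
  refine ⟨(wtHom wt).liftOfSurjective hwt ⟨ψ, hψ⟩, fun a => ?_⟩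
  rw [← wtHom_single (wt := wt) a, AddMonoidHom.liftOfRightInverse_comp_apply]
  change ∑ c, ((Pi.single a (1 : ℤ) : n → ℤ) c : k) * δ c = δ a
  rw [Finset.sum_eq_single a (fun c _ hc => by simp [Pi.single_eq_of_ne hc]) (by simp)]
  simp

/-- **`Lie (T_X) ≤ 𝔱_V`**: a tangent vector to the weight torus at `1` is a diagonal matrix
`diag (ℓ (wt a))` with `ℓ ∈ Hom(X, k)` (the differentials of the off-diagonal coordinates and of
the monomial relations; Springer 3.2.10 (4), 4.4). Over any field, for weights generating `X`.
[folklore] -/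
theorem lieAlgebraGL_weightTorus_le (hwt : Function.Surjective (wtHom wt)) :
    lieAlgebraGL (weightTorus k wt) ≤ torusLie (k := k) wt := by
  intro A hA
  rw [mem_lieAlgebraGL_iff] at hA
  -- `A` is diagonal
  have hoff : ∀ a c, a ≠ c → A a c = 0 := fun a c hac => by
    have h := hA _ (X_inl_mem_vanishingIdeal_weightTorus hac)
    rwa [tangentDeriv_X] at h
  -- the diagonal entries kill the relations
  have hrel : ∀ v ∈ (wtHom wt).ker, ∑ a, (v a : k) * A a a = 0 := by
    intro v hv
    have h := hA _ (diagMonomial_sub_mem_vanishingIdeal_weightTorus hv)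
    rw [tangentDeriv_sub, tangentDeriv_diagMonomial, tangentDeriv_diagMonomial,
      ← Finset.sum_sub_distrib] at h
    rw [← h]
    refine Finset.sum_congr rfl fun a _ => ?_
    rw [← sub_mul, ← Int.cast_natCast, ← Int.cast_natCast (R := k) (-v a).toNat, ← Int.cast_sub,
      toNat_sub_toNat_neg_eq]
  obtain ⟨ℓ, hℓ⟩ := exists_addMonoidHom_of_forall_ker hwt hrel
  refine ⟨ℓ, ?_⟩
  rw [torusDiagLin_apply]
  ext a c
  rw [torusDiag_apply]
  split_ifs with hac
  · subst hac; exact hℓ a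
  · exact (hoff a c hac).symm

end Vanishing

/-! ### The dimension of `𝔱_V` -/

section TorusLieDim

variable {wt : n → X}

/-- `ℓ ↦ D_ℓ` is injective when the weights generate `X`. [folklore] -/
lemma torusDiagLin_injective (hwt : Function.Surjective (wtHom wt)) :
    Function.Injective (torusDiagLin (k := k) wt) := by
  classical
  intro ℓ ℓ' h
  have ha : ∀ a, ℓ (wt a) = ℓ' (wt a) := fun a => by
    have := congrFun (congrFun h a) a
    rwa [torusDiagLin_apply, torusDiagLin_apply, torusDiag_apply, torusDiag_apply, if_pos rfl,
      if_pos rfl] at this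
  ext x
  obtain ⟨v, rfl⟩ := hwt x
  simp only [wtHom_apply, map_sum, map_zsmul, ha]

omit [Fintype n] [DecidableEq n] in
/-- `Hom(X, k)` has `k`-dimension `rank X` for a finitely generated free lattice `X`. [folklore] -/
lemma finrank_addMonoidHom_eq [Module.Free ℤ X] [Module.Finite ℤ X] :
    Module.finrank k (X →+ k) = Module.finrank ℤ X := by
  let bX := Module.finBasis ℤ X
  let e : (X →+ k) ≃ₗ[k] (Fin (Module.finrank ℤ X) → k) :=
    (addMonoidHomLequivInt (A := X) (B := k) k).trans (bX.constr k).symm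
  rw [e.finrank_eq, Module.finrank_fin_fun]

/-- **`dim 𝔱_V = rank X`** when the weights generate the finitely generated free lattice `X`.
[folklore] -/
theorem finrank_torusLie [Module.Free ℤ X] [Module.Finite ℤ X]
    (hwt : Function.Surjective (wtHom wt)) :
    Module.finrank k (torusLie (k := k) wt) = Module.finrank ℤ X := by
  rw [torusLie, LinearMap.finrank_range_of_inj (torusDiagLin_injective hwt),
    finrank_addMonoidHom_eq]

end TorusLieDim

/-! ### Functoriality of weight tori in the lattice -/

section Functorial

variable {wt : n → X} {X' : Type*} [AddCommGroup X']

omit [DecidableEq n] in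
/-- `wtHom (f ∘ wt) = f ∘ wtHom wt`. [folklore] -/
lemma wtHom_comp_apply (f : X →+ X') (v : n → ℤ) : wtHom (f ∘ wt) v = f (wtHom wt v) := by
  simp only [wtHom_apply, map_sum, map_zsmul, Function.comp_apply]

omit [DecidableEq n] in
/-- Composite weights generate when `f` and the weights do. [folklore] -/
lemma wtHom_comp_surjective {f : X →+ X'} (hf : Function.Surjective f)
    (hwt : Function.Surjective (wtHom wt)) : Function.Surjective (wtHom (f ∘ wt)) := by
  intro x'
  obtain ⟨x, rfl⟩ := hf x'
  obtain ⟨v, rfl⟩ := hwt x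
  exact ⟨v, wtHom_comp_apply f v⟩

/-- `weightTorusHom` of composite weights: `diag (χ' (f (wt a))) = diag ((χ' ∘ f) (wt a))`.
[folklore] -/
lemma weightTorusHom_comp (f : X →+ X') (χ' : Multiplicative X' →* kˣ) :
    weightTorusHom k (f ∘ wt) χ' = weightTorusHom k wt (χ'.comp (AddMonoidHom.toMultiplicative f)) :=
  rfl

/-- **The weight torus of composite weights is contained in the weight torus.** [folklore] -/
lemma weightTorus_comp_le (f : X →+ X') : weightTorus k (f ∘ wt) ≤ weightTorus k wt := by
  rintro _ ⟨χ', rfl⟩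
  exact ⟨χ'.comp (AddMonoidHom.toMultiplicative f), (weightTorusHom_comp f χ').symm⟩

end Functorial

/-! ### The dimension of the weight torus: `rank X ≤ dim T_X` -/

section Dimension

variable {wt : n → X} [Module.Free ℤ X] [Module.Finite ℤ X]

/-- The truncation `ℤ^r → ℤ^s` to the first `s` coordinates (`s ≤ r`). [folklore] -/
def truncFin {r s : ℕ} (h : s ≤ r) : (Fin r → ℤ) →+ (Fin s → ℤ) :=
  (LinearMap.funLeft ℤ ℤ (Fin.castLE h)).toAddMonoidHom

omit [Fintype n] [DecidableEq n] [Module.Free ℤ X] [Module.Finite ℤ X] in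
/-- Unfolding of `truncFin`. [folklore] -/
@[simp] lemma truncFin_apply {r s : ℕ} (h : s ≤ r) (v : Fin r → ℤ) (i : Fin s) :
    truncFin h v i = v (Fin.castLE h i) := rfl

omit [Fintype n] [DecidableEq n] [Module.Free ℤ X] [Module.Finite ℤ X] in
/-- Truncation is surjective (extend by zero). [folklore] -/
lemma truncFin_surjective {r s : ℕ} (h : s ≤ r) : Function.Surjective (truncFin h) := by
  intro w
  refine ⟨fun j => if hj : (j : ℕ) < s then w ⟨j, hj⟩ else 0, ?_⟩
  funext i
  simp [truncFin_apply, Fin.castLE, i.2]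

omit [Fintype n] [DecidableEq n] [Module.Free ℤ X] [Module.Finite ℤ X] in
/-- Truncations compose. [folklore] -/
lemma truncFin_comp {r s s' : ℕ} (h : s ≤ s') (h' : s' ≤ r) (v : Fin r → ℤ) :
    truncFin h (truncFin h' v) = truncFin (h.trans h') v := by
  funext i; rfl

omit [Fintype n] [DecidableEq n] in
variable (X) in
/-- The truncated coordinate map `X → ℤ^s`: the first `s` coordinates in the ℤ-basis
`Module.finBasis ℤ X`. [folklore] -/
def truncCoord {s : ℕ} (h : s ≤ Module.finrank ℤ X) : X →+ (Fin s → ℤ) :=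
  (truncFin h).comp (Module.finBasis ℤ X).equivFun.toLinearMap.toAddMonoidHom

omit [Fintype n] [DecidableEq n] in
/-- `truncCoord` is surjective. [folklore] -/
lemma truncCoord_surjective {s : ℕ} (h : s ≤ Module.finrank ℤ X) :
    Function.Surjective (truncCoord X h) :=
  (truncFin_surjective h).comp (Module.finBasis ℤ X).equivFun.surjective

omit [Fintype n] [DecidableEq n] in
/-- Truncated coordinate maps compose. [folklore] -/
lemma truncFin_comp_truncCoord {s s' : ℕ} (h : s ≤ s') (h' : s' ≤ Module.finrank ℤ X) :
    (truncFin h).comp (truncCoord X h') = truncCoord X (h.trans h') := by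
  ext x i
  rfl

variable (wt) in
/-- The truncated coordinate weights `wt_s : n → ℤ^s`: the first `s` coordinates of the weights in
the ℤ-basis `Module.finBasis ℤ X`. [folklore] -/
def truncWt {s : ℕ} (h : s ≤ Module.finrank ℤ X) : n → (Fin s → ℤ) := truncCoord X h ∘ wt

omit [Fintype n] [DecidableEq n] in
/-- `wt_s = truncFin ∘ wt_{s'}` for `s ≤ s'`. [folklore] -/
lemma truncWt_eq_comp {s s' : ℕ} (h : s ≤ s') (h' : s' ≤ Module.finrank ℤ X) :
    truncWt wt (h.trans h') = truncFin h ∘ truncWt wt h' := by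
  rw [truncWt, truncWt, ← truncFin_comp_truncCoord h h']
  rfl

omit [DecidableEq n] in
/-- The truncated weights generate `ℤ^s` when the weights generate `X`. [folklore] -/
lemma truncWt_surjective (hwt : Function.Surjective (wtHom wt)) {s : ℕ}
    (h : s ≤ Module.finrank ℤ X) : Function.Surjective (wtHom (truncWt wt h)) :=
  wtHom_comp_surjective (truncCoord_surjective h) hwt

/-- The tori of truncated weights increase with `s`. [folklore] -/
lemma weightTorus_truncWt_mono {s s' : ℕ} (h : s ≤ s') (h' : s' ≤ Module.finrank ℤ X) :
    weightTorus k (truncWt wt (h.trans h')) ≤ weightTorus k (truncWt wt h') := by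
  rw [truncWt_eq_comp h h']
  exact weightTorus_comp_le _

/-- The tori of truncated weights lie in `T_X`. [folklore] -/
lemma weightTorus_truncWt_le {s : ℕ} (h : s ≤ Module.finrank ℤ X) :
    weightTorus k (truncWt wt h) ≤ weightTorus k wt :=
  weightTorus_comp_le (truncCoord X h)

/-- **`T_s ≠ T_{s+1}`**: the character `v ↦ c ^ {v_s}` of `ℤ^{s+1}` (`c ≠ 1`) gives an element of
`T_{s+1}` outside `T_s` (by the injectivity of `Hom(ℤ^{s+1}, kˣ) → T_{s+1}` for generating
weights). [folklore] -/
lemma weightTorus_truncWt_ne (hwt : Function.Surjective (wtHom wt)) {c : kˣ} (hc : c ≠ 1)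
    {s : ℕ} (h' : s + 1 ≤ Module.finrank ℤ X) :
    weightTorus k (truncWt wt ((Nat.le_succ s).trans h')) ≠ weightTorus k (truncWt wt h') := by
  -- the character `v ↦ c ^ v (last)`
  let ev : Multiplicative (Fin (s + 1) → ℤ) →* Multiplicative ℤ :=
    AddMonoidHom.toMultiplicative (Pi.evalAddMonoidHom (fun _ : Fin (s + 1) => ℤ) (Fin.last s))
  let χc : Multiplicative (Fin (s + 1) → ℤ) →* kˣ := (zpowersHom kˣ c).comp ev
  have hχc : ∀ v : Fin (s + 1) → ℤ, χc (Multiplicative.ofAdd v) = c ^ v (Fin.last s) := fun v => by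
    simp [χc, ev]
  intro heq
  have hmem : weightTorusHom k (truncWt wt h') χc ∈
      weightTorus k (truncWt wt ((Nat.le_succ s).trans h')) := by
    rw [heq]; exact ⟨χc, rfl⟩
  obtain ⟨ψ, hψ⟩ := hmem
  rw [truncWt_eq_comp (Nat.le_succ s) h', weightTorusHom_comp] at hψ
  have hinj := weightTorusHom_injective (k := k) (truncWt_surjective hwt h') hψ
  -- evaluate at the last basis vector
  have h1 := DFunLike.congr_fun hinj (Multiplicative.ofAdd (Pi.single (Fin.last s) 1))
  rw [hχc, Pi.single_eq_same, zpow_one, MonoidHom.comp_apply,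
    AddMonoidHom.toMultiplicative_apply_apply, toAdd_ofAdd] at h1
  have h0 : truncFin (Nat.le_succ s) (Pi.single (Fin.last s) (1 : ℤ)) = 0 := by
    funext i
    rw [truncFin_apply, Pi.zero_apply, Pi.single_eq_of_ne]
    exact fun hh => (Nat.lt_irrefl s) (by
      have := congrArg Fin.val hh; simp at this; omega)
  rw [h0, ofAdd_zero, map_one] at h1
  exact hc h1.symm

/-- **`s ≤ dim T_s`** for the tori of truncated weights, by induction on `s` along the strictly
increasing chain `T_0 < T_1 < ⋯` (Springer 1.8.2). [folklore] -/
lemma le_zdim_weightTorus_truncWt [IsAlgClosed k] (hwt : Function.Surjective (wtHom wt)) (s : ℕ)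
    (h : s ≤ Module.finrank ℤ X) :
    s ≤ (isZConnected_weightTorus (k := k) (truncWt_surjective hwt h)).zdim := by
  induction s with
  | zero => exact Nat.zero_le _
  | succ s ih =>
    classical
    have hs : s ≤ Module.finrank ℤ X := (Nat.le_succ s).trans h
    -- an element `c ≠ 0, 1` of the infinite field `k`
    obtain ⟨x, hx⟩ := Infinite.exists_notMem_finset ({(0 : k), 1} : Finset k)
    have hx0 : x ≠ 0 := fun h0 => hx (by simp [h0])
    have hx1 : x ≠ 1 := fun h1 => hx (by simp [h1])
    have hc : Units.mk0 x hx0 ≠ 1 := fun h1 => hx1 (by simpa using congrArg Units.val h1)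
    have hlt : weightTorus k (truncWt wt ((Nat.le_succ s).trans h)) <
        weightTorus k (truncWt wt h) :=
      lt_of_le_of_ne (weightTorus_truncWt_mono (Nat.le_succ s) h)
        (weightTorus_truncWt_ne hwt hc h)
    have hzlt := (isZConnected_weightTorus (k := k) (truncWt_surjective hwt hs)).zdim_lt_of_lt
      (isZConnected_weightTorus (k := k) (truncWt_surjective hwt h)) hlt
    have ih' := ih hs
    omega

/-- **`rank X ≤ dim T_X`** (over an algebraically closed field, weights generating the free
lattice `X`): `T_X` contains the chain `T_0 < ⋯ < T_r` of tori of truncated weights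
(in fact `dim T_X = rank X`, `zdim_weightTorus_eq`). [cite: SpringerLAG1998, 3.2.7] -/
theorem rank_le_zdim_weightTorus [IsAlgClosed k] (hwt : Function.Surjective (wtHom wt)) :
    Module.finrank ℤ X ≤ (isZConnected_weightTorus (k := k) hwt).zdim :=
  (le_zdim_weightTorus_truncWt hwt _ le_rfl).trans
    ((isZConnected_weightTorus (k := k) (truncWt_surjective hwt le_rfl)).zdim_le_of_le
      (isZConnected_weightTorus (k := k) hwt) (weightTorus_truncWt_le le_rfl))

/-- **`Lie (T_X) = 𝔱_V`**: the Lie algebra of the weight torus is the space of diagonal matrices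
`diag (ℓ (wt a))`, `ℓ ∈ Hom(X, k)` (over an algebraically closed field, weights generating the
free lattice `X`): `Lie (T_X) ≤ 𝔱_V` by the equations, and
`dim Lie (T_X) = dim T_X ≥ rank X = dim 𝔱_V` (Springer 3.2.7, 4.4.6).
[cite: SpringerLAG1998, 3.2.7 with 4.4.6] -/
theorem lieAlgebraGL_weightTorus_eq [IsAlgClosed k] (hwt : Function.Surjective (wtHom wt)) :
    lieAlgebraGL (weightTorus k wt) = torusLie (k := k) wt := by
  have hT := isZConnected_weightTorus (k := k) hwt
  haveI := hT.finrank_lieAlgebraGL_eq.1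
  refine Submodule.eq_of_le_of_finrank_le (lieAlgebraGL_weightTorus_le hwt) ?_
  rw [finrank_torusLie hwt, hT.finrank_lieAlgebraGL_eq.2]
  exact rank_le_zdim_weightTorus hwt

/-- **`dim T_X = rank X`** (Springer 3.2.7). [cite: SpringerLAG1998, 3.2.7] -/
theorem zdim_weightTorus_eq [IsAlgClosed k] (hwt : Function.Surjective (wtHom wt)) :
    (isZConnected_weightTorus (k := k) hwt).zdim = Module.finrank ℤ X := by
  have hT := isZConnected_weightTorus (k := k) hwt
  rw [← hT.finrank_lieAlgebraGL_eq.2, lieAlgebraGL_weightTorus_eq hwt, finrank_torusLie hwt]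

/-- `D_ℓ ∈ Lie (T_X)` for every `ℓ ∈ Hom(X, k)`. [folklore] -/
theorem torusDiag_mem_lieAlgebraGL_weightTorus [IsAlgClosed k]
    (hwt : Function.Surjective (wtHom wt)) (ℓ : X →+ k) :
    torusDiag wt ℓ ∈ lieAlgebraGL (weightTorus k wt) := by
  rw [lieAlgebraGL_weightTorus_eq hwt]
  exact torusDiag_mem_torusLie ℓ

end Dimension

end Literature.NumberTheory.Automorphic
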